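/-
Copyright (c) 2026 the pub-hodgecm-mathlib formalisation cell (harness21).  R90-TF SLAB, section S10 (Rogawski 1990, §13.8 read at `v`),
prover R90-C138-p08 (g2) — DEAL #84 (R90-C138-plan (g4) 2026-09-05T03:33:34Z, RULING R15 «J-hbc-adm»): the two-case ASSEMBLER of the keystone's
`hbc` binder from its `hex` binder; h413 = `stmt-HodgeConjecture-24833`, route `HCCMUnconditional`.
-/
import Summits.HodgeConjecture.HodgeConjecture.Theorems.R90S10GermPinOfHeckeFL              -- ★ p864959 (K2E3-p21): INERT rigidity `unopClassSphericalCharacter_eq_of_liesOver_of_heckeFLAt`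
import Summits.HodgeConjecture.HodgeConjecture.Theorems.R90S10BCSphericalRigiditySplit      -- ★ p864906 (K2Liu-p13): SPLIT rigidity `eq_and_unopClassSphericalCharacter_eq_of_liesOver_frozen_of_split` (+ ★ C2 `S10FrozenDatum`)
import Summits.HodgeConjecture.HodgeConjecture.Theorems.R90S10IntegralTransportInert         -- ★ p864997 (K2E3-p21): `exists_integralTransport_of_inert` (the adic transports `eG`, `eH`)
import Summits.HodgeConjecture.HodgeConjecture.Theorems.R90S10IsUnramifiedInOfPlacesOver     -- ★ `isUnramifiedIn_of_forall_placesOver` (⟪U⟫ ⇒ Mathlib's `IsUnramifiedIn`)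
import HarnessLib

/-!
# R90-TF ∕ S10 — THE KEYSTONE'S `hbc` FROM ITS `hex`: the two-case assembler `hbc_of_hex` (`Theorems/R90S10HbcOfRecord.lean`;
# ns `Summit.HodgeConjecture.HodgeConjecture.R90.S10`; theorems only — no `def`, no instance, no notation, no `sorry`)

Print: [Rogawski1990] §13.8 p. 219 L3 «`π_w = ξ_H(ρ_w)` for all `w ≠ v` and all `π` occurring in the sum»; §4.9 Prop. 4.9.1 (b) p. 55 (the fundamental lemma for the spherical
Hecke algebra at an inert unramified place) with Lemma 4.9.2 pp. 55–56 (`Tr(i_G(χ)(f)) = Tr(i_H(χμ⁻¹)(f^H))`); §4.13 Lemma 4.13.1 (a) pp. 64–66 (split places); §13.6 p. 209 (e.v.p.'s);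
[CartierCorvallis1979, §IV.1 Thm. 4.1, Cor. 4.1–4.2] (a spherical class is determined by its Hecke eigencharacter).

## WHAT THIS FILE PROVES (RULING R15 «J-hbc-adm», dealer R90-C138-plan (g4) 2026-09-05T03:33:34Z)
The S10 keystone ★ `sock₂Sig_of_inputs` (p07) binds, at every finite `w ≠ v` off the germ set `S`, TWO local inputs about the spherical Hecke eigencharacter `(t₀)_w`:
* `hex` (the ∃-form PIN): «there IS an admissible `U(Φ₃)(𝒪_w)`-spherical class `π₀` of character `(t₀)_w` LYING OVER `ρ_w`» (for the frozen levels ∕ measures ∕ orbital families of the datum);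
* `hbc` (hadm-form, R15): «EVERY admissible `U(Φ₃)(𝒪_w)`-spherical class `πw` lying over `ρ_w` has character `(t₀)_w`».
`hbc_of_hex` PAYS `hbc` FROM `hex` by RIGIDITY OF THE `LiesOver`-FIBRE — two admissible spherical classes lying over the same `ρ_w` have the same spherical character — case by case on a
place `W ∣ w` of `L`:
* `W` FIXED by complex conjugation (inert; `w` unramified in `L/L⁺` by ⟪U⟫): ★ `unopClassSphericalCharacter_eq_of_liesOver_of_heckeFLAt` (p864959) — needs the HECKE-FL input at `w`
  (the (E1-c)-class letter: Prop. 4.9.1 (b) for the full spherical Hecke algebra, in the Satake-eigencharacter graph form of the tree) for the adic transports `eG`, `eH` of ★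
  `exists_integralTransport_of_inert` (p864997); since the transports are produced INSIDE the proof, the letter is bound ∀-quantified over transports (`hFL`, exactly as the S6 floor
  `StubR90ExtE1HeckeFL` quantifies them) — a BY-VALUE binder, never discharged here;
* `W` MOVED by complex conjugation (split): ★ `eq_and_unopClassSphericalCharacter_eq_of_liesOver_frozen_of_split` (p864906) — needs `μ` conjugate-self-dual (`hdual`) and `μ` unramified at `W`
  (from ⟪U⟫).
Binders (by value, named for their payers): `hunr` (A's ⟪U⟫), `hdual` (the CM unitary character's conjugate-duality, E1∕A datum), `hFL` ((E1-c) at every inert `w ≠ v` off `S` — S6 floor by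
name where it applies, NAMED RESIDUAL (E1-c)⁺ at inert `w ∈ Sbad`), `hex` (keystone §1 :181–:183 verbatim, at a bare e.v.p. `t₀`; the keystone passes `t₀.1`).  Conclusion = the keystone
v2's hadm-form `hbc` VERBATIM (`(hadm : πw.IsAdmissible)` right after `πw`); the `LiesOver` hypotheses are moved from the datum's level `𝔳.K w` to the
standard `U(Φ₃)(𝒪_w)` along ★ `S10Frozen.hKstd` before the inert rigidity is applied.
HONEST LABEL: an assembler over two ★ rigidity theorems; it DISCHARGES NOTHING of (E1-c) — the Hecke-FL letter `hFL` and `hdual` stay by-value inputs of the keystone's supplier; HC_CM is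
proved only modulo the 7 printed citations (2 remaining named inputs: hLiu418 = `stmt-HodgeConjecture-24832`, h413 = `stmt-HodgeConjecture-24833`) until rung 0 closes; REL ≠ ★ ≠ BUILT.
-/

set_option autoImplicit false
set_option linter.dupNamespace false

noncomputable section

open scoped Matrix MatrixGroups Pointwise
open MeasureTheory Measure MulAction NumberField IsDedekindDomain
open Literature.NumberTheory.Rogawski1990 Literature.NumberTheory.Automorphic Literature.NumberTheory.Automorphic.heckeAlgebra
open Literature.NumberTheory.Automorphic.UnitaryGroup Literature.NumberTheory.Automorphic.HermitianLattice Literature.NumberTheory.GaloisRepresentations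
open Summit.HodgeConjecture.HodgeConjecture.Cruxes.H413.K2E1TraceFormulaBeta
open Summit.HodgeConjecture.HodgeConjecture.Cruxes.H413.K2E1EvpOfAutomorphicClass (unopClassSphericalCharacter)

namespace Summit.HodgeConjecture.HodgeConjecture.R90.S10

section Frozen

variable (L : Type) [Field L] [NumberField L] [IsCMField L] [DecidableEq (Pl L)] (μ : HeckeCharacter L) (v : Pl L)
  [MeasurableSpace (HLoc L v)] [BorelSpace (HLoc L v)] [MeasurableSpace (Gqs L v)] [BorelSpace (Gqs L v)]
  (νHv : Measure (HLoc L v)) (νQv : Measure (Gqs L v)) [νHv.IsHaarMeasure] [νHv.IsMulRightInvariant] [νQv.IsHaarMeasure] [νQv.IsMulRightInvariant]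
  [∀ a : HLoc L v, MeasurableSpace (HLoc L v ⧸ Subgroup.centralizer ({a} : Set (HLoc L v)))]
  [∀ a : HLoc L v, BorelSpace (HLoc L v ⧸ Subgroup.centralizer ({a} : Set (HLoc L v)))]
  [∀ γ : Gqs L v, MeasurableSpace (Gqs L v ⧸ Subgroup.centralizer ({γ} : Set (Gqs L v)))]
  [∀ γ : Gqs L v, BorelSpace (Gqs L v ⧸ Subgroup.centralizer ({γ} : Set (Gqs L v)))]
  (mHv : OrbitalMeasureFamily (HLoc L v)) (mQv : OrbitalMeasureFamily (Gqs L v)) (πSt : IrrClass (HLoc L v))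
  [MeasurableSpace (G3 L).Adelic] [BorelSpace (G3 L).Adelic] [MeasurableSpace (H2 L).Adelic] [BorelSpace (H2 L).Adelic]
  [MeasurableSpace (GArch L)] [BorelSpace (GArch L)] [MeasurableSpace (HArch L)] [BorelSpace (HArch L)]
  [MeasurableSpace (H1Loc L v)] [MeasurableSpace (H1Arch L)] [MeasurableSpace (H1 L).Adelic] [BorelSpace (H1 L).Adelic]

/-! ## §1 The two-case assembler: `hex` (∃ a class of character `(t₀)_w` over `ρ_w`) ⟹ `hbc` (every admissible spherical class over `ρ_w` has character `(t₀)_w`) -/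

/-- **THE KEYSTONE'S `hbc` FROM ITS `hex` (RULING R15, hadm-form).**  For the frozen datum `𝔣' = ⟨𝔥, 𝔳, 𝔤⟩`, a germ set `S` and an e.v.p. `t₀` off `S`, suppose at every finite
`w ≠ v` off `S` SOME admissible `U(Φ₃)(𝒪_w)`-spherical class `π₀` of spherical character `(t₀)_w` lies over `ρ_w` (`hex`, «`ξ_H(ρ_w)` exists with character `(t₀)_w`»).  Then EVERY admissible
`U(Φ₃)(𝒪_w)`-spherical class `πw` lying over `ρ_w` has spherical character `(t₀)_w` (`hbc`): both lie over `ρ_w`, so they have the same spherical character — at a place `W ∣ w` FIXED by complex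
conjugation (inert, `w` unramified by ⟪U⟫ `hunr`) by ★ `unopClassSphericalCharacter_eq_of_liesOver_of_heckeFLAt` (the `LiesOver`-fibre is rigid given the spherical-Hecke-algebra FL
`hFL` at `w`, Prop. 4.9.1 (b) + Lemma 4.9.2, read at the adic transports of ★ `exists_integralTransport_of_inert`), at a place MOVED by it (split, `μ` unramified at `W` by ⟪U⟫) by ★
`eq_and_unopClassSphericalCharacter_eq_of_liesOver_frozen_of_split` (Lemma 4.13.1 (a), needs `hdual : μ^c = μ⁻¹`).  BY-VALUE inputs, named for their payers: `hunr` (⟪U⟫), `hdual`,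
`hFL` ((E1-c) at the inert `w ≠ v` off `S`, ∀-bound over the transports as the S6 floor states it), `hex` (the keystone's own binder).  Conclusion = keystone v2 §1's `hbc` VERBATIM.
[cite: Rogawski1990, §13.8 p. 219 L3; §4.9 Prop. 4.9.1 (b) p. 55, Lemma 4.9.2 pp. 55–56; §4.13 Lemma 4.13.1 (a) pp. 64–66; §13.6 p. 209] [cite: CartierCorvallis1979, §IV.1 Thm. 4.1, Cor. 4.1–4.2]
[cite: BlasiusRogawski1992, Thm. 1] -/
theorem hbc_of_hex (𝔣' : S10FrozenDatum L μ v νHv νQv mHv mQv πSt) (S : Set (Pl L))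
    (t₀ : Ch13Sec6.EigenvaluePackage S fun w => heckeAlgebra ℂ (Gqs L w) (cmLocalIntegralLevel L 3 (qsForm L) w))
    -- ⟪U⟫: every `W ∣ w`, `w ≠ v`, is unramified over `𝓞 L⁺` and `μ` is unramified at `W`
    (hunr : ∀ w : Pl L, w ≠ v → ∀ W : PlacesOver L w, Algebra.IsUnramifiedAt (𝓞 ↥(maximalRealSubfield L)) W.1.asIdeal ∧ μ.IsUnramifiedAt W.1)
    -- the CM unitary character is conjugate-self-dual (split places)
    (hdual : HeckeCharacter.galConj (IsCMField.complexConj L) μ = μ⁻¹)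
    -- (E1-c): the spherical-Hecke-algebra FL at every INERT `w ≠ v` off `S`, for all adic transports (Satake-eigencharacter graph form, ★ p864959 :321–:338 at the frozen families)
    (hFL : ∀ (w : {w : Pl L // w ≠ v}) (_ : w.1 ∉ S) (W : PlacesOver L w.1) (hW : IsCMField.complexConj L • W.1 = W.1)
        (hw : Algebra.IsUnramifiedIn (R := 𝓞 ↥(maximalRealSubfield L)) (𝓞 L) w.1.asIdeal)
        (eG : Gqs L w.1 ≃ₜ* ↥(unitaryGroupOfForm (galAdicCompletionMap (L := L) (IsCMField.complexConj L) hW) ((StdForm.antidiagonal 3).over (W.1.adicCompletion L))))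
        (_ : ∀ g : Gqs L w.1,
          eG g ∈ unitaryInt (galAdicCompletionMap (L := L) (IsCMField.complexConj L) hW) ((StdForm.antidiagonal 3).over (W.1.adicCompletion L)) ↔
            g ∈ cmLocalIntegralLevel L 3 (qsForm L) w.1)
        (eH : H2Loc L w.1 ≃ₜ* ↥(unitaryGroupOfForm (galAdicCompletionMap (L := L) (IsCMField.complexConj L) hW) ((StdForm.antidiagonal 2).over (W.1.adicCompletion L))))
        (_ : ∀ h : H2Loc L w.1,
          eH h ∈ unitaryInt (galAdicCompletionMap (L := L) (IsCMField.complexConj L) hW) ((StdForm.antidiagonal 2).over (W.1.adicCompletion L)) ↔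
            h ∈ cmLocalIntegralLevel L 2 (Matrix.of fun i j : Fin 2 => if i.val + j.val + 1 = 2 then (1 : L) else 0) w.1)
        (φ : heckeAlgebra ℂ ↥(unitaryGroupOfForm (galAdicCompletionMap (L := L) (IsCMField.complexConj L) hW) ((StdForm.antidiagonal 3).over (W.1.adicCompletion L)))
          (unitaryInt (galAdicCompletionMap (L := L) (IsCMField.complexConj L) hW) ((StdForm.antidiagonal 3).over (W.1.adicCompletion L))))
        (φH : heckeAlgebra ℂ ↥(unitaryGroupOfForm (galAdicCompletionMap (L := L) (IsCMField.complexConj L) hW) ((StdForm.antidiagonal 2).over (W.1.adicCompletion L)))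
          (unitaryInt (galAdicCompletionMap (L := L) (IsCMField.complexConj L) hW) ((StdForm.antidiagonal 2).over (W.1.adicCompletion L)))),
      (∀ z : ℂˣ, unitaryHeckeEigencharacterAdic (IsCMField.complexConj L) (IsCMField.complexConj_ne_one L) w.1 W hW hw ![z, 1] φH =
          unitaryHeckeEigencharacterAdic (IsCMField.complexConj L) (IsCMField.complexConj_ne_one L) w.1 W hW hw ![-z, 1, 1] φ) →
      letI := 𝔣'.𝔳.qH w
      letI := 𝔣'.𝔳.qQ w
      IsLocalDeltaTransfer L (qsForm L) w.1
        ((finExplicitCollection L (qsForm L) μ (finExplicitDelta_conj_left_all L (qsForm L) μ) (finExplicitDelta_conj_right_all L (qsForm L) μ)) w.1) (𝔣'.𝔳.mH w) (𝔣'.𝔳.mQ w)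
        (fun h : HLoc L w.1 =>
          (toVector (unitaryInt (galAdicCompletionMap (L := L) (IsCMField.complexConj L) hW) ((StdForm.antidiagonal 2).over (W.1.adicCompletion L))) φH).coeff
            ((eH h.1 : ↥(unitaryGroupOfForm (galAdicCompletionMap (L := L) (IsCMField.complexConj L) hW) ((StdForm.antidiagonal 2).over (W.1.adicCompletion L)))) :
              ↥(unitaryGroupOfForm (galAdicCompletionMap (L := L) (IsCMField.complexConj L) hW) ((StdForm.antidiagonal 2).over (W.1.adicCompletion L))) ⧸
                unitaryInt (galAdicCompletionMap (L := L) (IsCMField.complexConj L) hW) ((StdForm.antidiagonal 2).over (W.1.adicCompletion L))))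
        (fun g : Gqs L w.1 =>
          (toVector (unitaryInt (galAdicCompletionMap (L := L) (IsCMField.complexConj L) hW) ((StdForm.antidiagonal 3).over (W.1.adicCompletion L))) φ).coeff
            ((eG g : ↥(unitaryGroupOfForm (galAdicCompletionMap (L := L) (IsCMField.complexConj L) hW) ((StdForm.antidiagonal 3).over (W.1.adicCompletion L)))) :
              ↥(unitaryGroupOfForm (galAdicCompletionMap (L := L) (IsCMField.complexConj L) hW) ((StdForm.antidiagonal 3).over (W.1.adicCompletion L))) ⧸
                unitaryInt (galAdicCompletionMap (L := L) (IsCMField.complexConj L) hW) ((StdForm.antidiagonal 3).over (W.1.adicCompletion L)))))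
    -- the ∃-form PIN (keystone §1 :181–:183, at the bare e.v.p. `t₀`; the keystone passes `t₀.1`)
    (hex : ∀ (w : {w : Pl L // w ≠ v}) (hwS : w.1 ∉ S), ∃ π₀ : IrrClass (Gqs L w.1), π₀.IsAdmissible ∧ ∃ h₀ : π₀.IsSpherical (cmLocalIntegralLevel L 3 (qsForm L) w.1),
      unopClassSphericalCharacter (cmLocalIntegralLevel L 3 (qsForm L) w.1) π₀ h₀ = t₀ ⟨w.1, hwS⟩ ∧
        LiesOver L μ w.1 (𝔣'.𝔳.K w.1) (𝔣'.𝔥.KH w.1) (𝔣'.𝔳.νQ w) (𝔣'.𝔳.νHw w) (𝔣'.𝔳.mH w) (𝔣'.𝔳.mQ w) π₀ (𝔣'.𝔥.ρ w.1)) :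
    ∀ (w : {w : Pl L // w ≠ v}) (hwS : w.1 ∉ S) (πw : IrrClass (Gqs L w.1)) (hadm : πw.IsAdmissible) (hsph : πw.IsSpherical (cmLocalIntegralLevel L 3 (qsForm L) w.1)),
      LiesOver L μ w.1 (𝔣'.𝔳.K w.1) (𝔣'.𝔥.KH w.1) (𝔣'.𝔳.νQ w) (𝔣'.𝔳.νHw w) (𝔣'.𝔳.mH w) (𝔣'.𝔳.mQ w) πw (𝔣'.𝔥.ρ w.1) →
        unopClassSphericalCharacter (cmLocalIntegralLevel L 3 (qsForm L) w.1) πw hsph = t₀ ⟨w.1, hwS⟩ := by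
  intro w hwS πw hadm hsph hLO
  obtain ⟨π₀, hadm₀, h₀, ht, hLO₀⟩ := hex w hwS
  rw [← ht]
  obtain ⟨W⟩ : Nonempty (PlacesOver L w.1) := inferInstance
  by_cases hW : IsCMField.complexConj L • W.1 = W.1
  · -- INERT (or a non-split `W`): `w` is unramified in `L/L⁺` by ⟪U⟫; rigidity of the `LiesOver`-fibre from the Hecke-FL at the adic transports
    have hw : Algebra.IsUnramifiedIn (R := 𝓞 ↥(maximalRealSubfield L)) (𝓞 L) w.1.asIdeal :=
      isUnramifiedIn_of_forall_placesOver L w.1 fun W' => (hunr w.1 w.2 W').1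
    obtain ⟨⟨eG, heG⟩, ⟨eH, heH⟩⟩ := exists_integralTransport_of_inert L w.1 W hW
    -- the datum's structures at `w` (let-bound, so that the ★ theorem's instance arguments are these very terms)
    letI := 𝔣'.𝔳.msG w; letI := 𝔣'.𝔳.bsG w; letI := 𝔣'.𝔳.msH w; letI := 𝔣'.𝔳.qQ w; letI := 𝔣'.𝔳.qH w; letI := 𝔣'.𝔳.hνQ w
    letI := 𝔣'.𝔥.acV; letI := 𝔣'.𝔥.mdV
    -- move the two `LiesOver` hypotheses from the datum's level `𝔳.K w` to the standard level `U(Φ₃)(𝒪_w)` (★ `hKstd`)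
    have hKstd : 𝔣'.𝔳.K w.1 = cmLocalIntegralLevel L 3 (qsForm L) w.1 := 𝔣'.𝔳.hKstd w.1 w.2
    have hLO' : LiesOver L μ w.1 (cmLocalIntegralLevel L 3 (qsForm L) w.1) (𝔣'.𝔥.KH w.1) (𝔣'.𝔳.νQ w) (𝔣'.𝔳.νHw w) (𝔣'.𝔳.mH w) (𝔣'.𝔳.mQ w)
        πw (𝔣'.𝔥.ρ w.1) := hKstd ▸ hLO
    have hLO₀' : LiesOver L μ w.1 (cmLocalIntegralLevel L 3 (qsForm L) w.1) (𝔣'.𝔥.KH w.1) (𝔣'.𝔳.νQ w) (𝔣'.𝔳.νHw w) (𝔣'.𝔳.mH w) (𝔣'.𝔳.mQ w)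
        π₀ (𝔣'.𝔥.ρ w.1) := hKstd ▸ hLO₀
    obtain ⟨hKc, hKo⟩ := isCompact_isOpen_cmLocalIntegralLevel L 3 (qsForm L) w.1
    have hKH : ∀ k ∈ 𝔣'.𝔥.KH w.1, k.1 ∈ cmLocalIntegralLevel L 2 (Matrix.of fun i j : Fin 2 => if i.val + j.val + 1 = 2 then (1 : L) else 0) w.1 := by
      intro k hk
      rw [𝔣'.𝔥.hKH, Subgroup.mem_prod] at hk
      rw [← 𝔣'.𝔥.hK₂std w.1 w.2]
      exact hk.1
    exact unopClassSphericalCharacter_eq_of_liesOver_of_heckeFLAt L μ w.1 (cmLocalIntegralLevel L 3 (qsForm L) w.1) (𝔣'.𝔥.KH w.1) (𝔣'.𝔳.νQ w) (𝔣'.𝔳.νHw w)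
      (𝔣'.𝔳.mH w) (𝔣'.𝔳.mQ w) hKo hKc W hW hw eG heG eH heH (𝔣'.𝔥.hKHo.out w.1) (𝔣'.𝔥.hKHc w.1) hKH
      (hFL w hwS W hW hw eG heG eH heH) (𝔣'.𝔥.ρ w.1) hadm hadm₀ hLO' hLO₀'
  · -- SPLIT: `μ` unramified at `W` by ⟪U⟫ and conjugate-self-dual ⇒ `πw = π₀`
    exact (eq_and_unopClassSphericalCharacter_eq_of_liesOver_frozen_of_split L μ v νHv νQv mHv mQv πSt 𝔣' w W hW (hunr w.1 w.2 W).2 hdual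
      hadm hadm₀ hLO hLO₀ hsph h₀).2

end Frozen

end Summit.HodgeConjecture.HodgeConjecture.R90.S10

end
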